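import Summits.HodgeConjecture.HodgeConjecture.Theorems.FormalLiftingFromClassLifting.Negative.OneStepClassLift
import Mathlib.LinearAlgebra.FreeModule.StrongRankCondition

/-!
# `FormalLiftingFromClassLifting` (stmt-HodgeConjecture-13825) · Negative · the vector-bundle converse

The one-step kill criterion of `Negative/OneStepClassLift.lean` (standing disprover, cycle 2) and the
implication `LiftsFormally ⇒ [E₁] ∈ im(K₀(X_2) → K₀(X_k))` carried the folklore converse
"vector bundle (Mathlib: locally free AND of finite type) ⇒ finite locally free" (Stacks 01C6 (2)) as a
HYPOTHESIS `hconv`, because the tree only proves `IsFiniteLocallyFree.isVectorBundle`. This file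
(cycle 4, refuter-cdisprove-stmt-HodgeConjecture-13825-g4-0, 2026-08-16) PROVES the converse on every
scheme and makes the kill criterion unconditional:

* `finite_of_epi_free`: on any ringed site whose endomorphism ring of the unit module is commutative
  and non-zero, an epimorphism `free K ↠ free I` with `K` finite forces `I` finite (dualise into
  `Hom(-, 𝒪)`: an injective `End(𝒪)`-linear map `End(𝒪)^(n+1) → End(𝒪)^K`, and the strong rank
  condition of non-zero commutative rings);
* `end_unit_mul_comm`, `end_unit_id_ne_zero`: on the site of opens over a NON-EMPTY open `W` of a
  scheme, `End(𝒪)` is commutative and `𝟙 ≠ 0`;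
* `isFiniteLocallyFree_of_isVectorBundle`: a vector bundle on a scheme is finite locally free (at `x`,
  restrict a trivialisation `E|_U ≅ 𝒪^I` and finitely many generators of `E|_V` to `W = U ∩ V ∋ x`);
* `exists_oneStepClassLift_of_liftsFormally`, `not_formalLiftingFromClassLifting_of_oneStepWitness'`:
  the cycle-2 statements with `hconv` discharged — ONE finite locally free `E₁` on a Hodge-torsion-free
  `𝒳` under the hypotheses of the crux with `[E₁] ⊗ 1` rationally pro-liftable and
  `[E₁] ∉ im(K₀(𝒳 ⊗ W/p²) → K₀(X_k))` refutes `FormalLiftingFromClassLifting` outright.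
-/

set_option linter.dupNamespace false

namespace Summit.HodgeConjecture.HodgeConjecture.Theorems.FormalLiftingFromClassLifting.Negative

open CategoryTheory AlgebraicGeometry Limits Opposite
open Literature.AlgebraicGeometry Literature.AlgebraicGeometry.Motives
open Literature.AlgebraicGeometry.Motives.WittScheme
open Summit.HodgeConjecture.HodgeConjecture.Theses.PadicSemiregularLift

noncomputable section

universe u v' u'

/-! ## Rank: an epimorphism `free K ↠ free I` with `K` finite forces `I` finite -/

section Rank

variable {C : Type u'} [Category.{v'} C] {J : GrothendieckTopology C} {R : Sheaf J RingCat.{u}}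
  [HasWeakSheafify J AddCommGrpCat.{u}] [J.WEqualsLocallyBijective AddCommGrpCat.{u}]

/-- Morphisms out of a free sheaf of modules are determined by their restrictions along the
tautological inclusions `ιFree i : 𝒪 ⟶ 𝒪^I` (Mathlib's `isColimitFreeCofan`, retyped on `free I`).
[folklore] -/
theorem free_hom_ext {I : Type u} {Z : SheafOfModules.{u} R} (f g : SheafOfModules.free I ⟶ Z)
    (h : ∀ i, SheafOfModules.ιFree i ≫ f = SheafOfModules.ιFree i ≫ g) : f = g :=
  Cofan.IsColimit.hom_ext (SheafOfModules.isColimitFreeCofan I) _ _ fun i => h i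

/-- **An epimorphism `𝒪^K ↠ 𝒪^I` of free sheaves of modules with `K` finite forces `I` finite**, on any
ringed site on which the endomorphism ring `End(𝒪)` of the unit module is commutative with `𝟙 ≠ 0`.
Proof: `Hom(-, 𝒪)` turns the epimorphism into an injective `End(𝒪)`-linear map
`End(𝒪)^I → End(𝒪)^K`; restrict it to `#K + 1` coordinates and apply the strong rank condition of
the non-zero commutative ring `End(𝒪)` (Mathlib's `card_le_of_injective`). [folklore] -/
theorem finite_of_epi_free {I K : Type u} [Finite K]
    (hcomm : ∀ a b : End (SheafOfModules.unit R), a * b = b * a)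
    (hnt : (𝟙 (SheafOfModules.unit R) : End (SheafOfModules.unit R)) ≠ 0)
    (π : SheafOfModules.free (R := R) K ⟶ SheafOfModules.free (R := R) I) [Epi π] : Finite I := by
  classical
  letI : CommRing (End (SheafOfModules.unit R)) :=
    { (inferInstance : Ring (End (SheafOfModules.unit R))) with mul_comm := hcomm }
  haveI : Nontrivial (End (SheafOfModules.unit R)) := ⟨⟨_, _, hnt⟩⟩
  by_contra hI
  rw [not_finite_iff_infinite] at hI
  haveI := Fintype.ofFinite K
  -- `#K + 1` distinct coordinates of `I`
  let emb : Fin (Fintype.card K + 1) ↪ I := Fin.valEmbedding.trans (Infinite.natEmbedding I)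
  -- extension by zero of a coefficient vector to all of `I`
  let δ : (Fin (Fintype.card K + 1) → End (SheafOfModules.unit R)) →
      I → End (SheafOfModules.unit R) :=
    fun c => Function.extend emb c (0 : I → End (SheafOfModules.unit R))
  have hδ_emb : ∀ c j, δ c (emb j) = c j := fun c j => emb.injective.extend_apply c 0 j
  have hδ_out : ∀ c i, (¬ ∃ j, emb j = i) → δ c i = 0 := fun c i hi =>
    Function.extend_apply' c (0 : I → End (SheafOfModules.unit R)) i hi
  have hδ_add : ∀ c c' i, δ (c + c') i = δ c i + δ c' i := by
    intro c c' i
    by_cases hi : ∃ j, emb j = i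
    · obtain ⟨j, rfl⟩ := hi
      rw [hδ_emb, hδ_emb, hδ_emb, Pi.add_apply]
    · rw [hδ_out c i hi, hδ_out c' i hi, hδ_out (c + c') i hi, add_zero]
  have hδ_smul : ∀ (b : End (SheafOfModules.unit R)) c i, δ (b • c) i = b * δ c i := by
    intro b c i
    by_cases hi : ∃ j, emb j = i
    · obtain ⟨j, rfl⟩ := hi
      rw [hδ_emb, hδ_emb, Pi.smul_apply, smul_eq_mul]
    · rw [hδ_out c i hi, hδ_out (b • c) i hi, mul_zero]
  -- the morphism `free I ⟶ 𝒪` with coordinates `δ c`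
  let D : (Fin (Fintype.card K + 1) → End (SheafOfModules.unit R)) →
      (SheafOfModules.free (R := R) I ⟶ SheafOfModules.unit R) :=
    fun c => Cofan.IsColimit.desc (SheafOfModules.isColimitFreeCofan I)
      (fun i => End.asHom (δ c i))
  have hD : ∀ c i, SheafOfModules.ιFree i ≫ D c = End.asHom (δ c i) :=
    fun c i => Cofan.IsColimit.fac (SheafOfModules.isColimitFreeCofan I) _ i
  have hD_add : ∀ c c', D (c + c') = D c + D c' := by
    intro c c'
    refine free_hom_ext _ _ fun i => ?_
    rw [Preadditive.comp_add, hD, hD, hD, hδ_add]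
    rfl
  have hD_smul : ∀ (b : End (SheafOfModules.unit R)) c, D (b • c) = D c ≫ End.asHom b := by
    intro b c
    refine free_hom_ext _ _ fun i => ?_
    rw [hD, ← Category.assoc, hD, hδ_smul]
    rfl
  -- the `End(𝒪)`-linear map `End(𝒪)^(#K+1) → End(𝒪)^K`, `c ↦ (k ↦ ι_k ≫ π ≫ D c)`
  let Φ : (Fin (Fintype.card K + 1) → End (SheafOfModules.unit R)) →ₗ[End (SheafOfModules.unit R)]
      (K → End (SheafOfModules.unit R)) :=
    { toFun := fun c k => End.of (SheafOfModules.ιFree k ≫ π ≫ D c)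
      map_add' := fun c c' => by
        funext k
        change End.of (SheafOfModules.ιFree k ≫ π ≫ D (c + c')) =
          End.of (SheafOfModules.ιFree k ≫ π ≫ D c) + End.of (SheafOfModules.ιFree k ≫ π ≫ D c')
        rw [hD_add, Preadditive.comp_add, Preadditive.comp_add]
        rfl
      map_smul' := fun b c => by
        funext k
        change End.of (SheafOfModules.ιFree k ≫ π ≫ D (b • c)) =
          b * End.of (SheafOfModules.ιFree k ≫ π ≫ D c)
        rw [hD_smul, End.mul_def]
        change SheafOfModules.ιFree k ≫ π ≫ D c ≫ End.asHom b =
          (SheafOfModules.ιFree k ≫ π ≫ D c) ≫ End.asHom b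
        simp only [Category.assoc] }
  have hΦ : Function.Injective Φ := by
    intro c c' hcc'
    rw [← sub_eq_zero] at hcc' ⊢
    rw [← map_sub] at hcc'
    have h0 : ∀ k, SheafOfModules.ιFree k ≫ π ≫ D (c - c') = 0 := fun k => congrFun hcc' k
    have h1 : π ≫ D (c - c') = 0 := by
      refine free_hom_ext _ _ fun k => ?_
      rw [comp_zero]
      exact h0 k
    have h2 : D (c - c') = 0 := by
      rw [← cancel_epi π, h1, comp_zero]
    funext j
    have h3 := hD (c - c') (emb j)
    rw [h2, comp_zero, hδ_emb] at h3
    exact h3.symm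
  have hcard := card_le_of_injective (End (SheafOfModules.unit R)) Φ hΦ
  simp only [Fintype.card_fin] at hcard
  omega

end Rank

/-! ## `End(𝒪)` on the opens over a non-empty open of a scheme -/

section EndUnit

variable {X : Scheme.{u}} (W : X.Opens)

/-- **`End(𝒪)` is commutative** on the site of opens over `W`: open by open an endomorphism of the
unit module is multiplication by its value on `1`, and the sections of `𝒪_X` are commutative rings.
[folklore] -/
theorem end_unit_mul_comm (a b : End (SheafOfModules.unit (X.ringCatSheaf.over W))) :
    a * b = b * a := by
  change b ≫ a = a ≫ b
  refine SheafOfModules.hom_ext (PresheafOfModules.hom_ext fun Y => ModuleCat.hom_ext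
    (LinearMap.ext fun y => ?_))
  let f : (X.ringCatSheaf.over W).obj.obj Y →ₗ[(X.ringCatSheaf.over W).obj.obj Y]
      (X.ringCatSheaf.over W).obj.obj Y := (a.val.app Y).hom
  let g : (X.ringCatSheaf.over W).obj.obj Y →ₗ[(X.ringCatSheaf.over W).obj.obj Y]
      (X.ringCatSheaf.over W).obj.obj Y := (b.val.app Y).hom
  obtain ⟨z, rfl⟩ : ∃ z : (X.ringCatSheaf.over W).obj.obj Y, z = y := ⟨y, rfl⟩
  change f (g z) = g (f z)
  have hf : ∀ t, f t = t * f 1 := fun t => by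
    have h := f.map_smul t 1
    rwa [smul_eq_mul, mul_one, smul_eq_mul] at h
  have hg : ∀ t, g t = t * g 1 := fun t => by
    have h := g.map_smul t 1
    rwa [smul_eq_mul, mul_one, smul_eq_mul] at h
  rw [hg z, hf (z * _), hf z, hg (z * _)]
  have key : ∀ r s t : Γ(X, Y.unop.left), r * s * t = r * t * s := fun r s t => mul_right_comm r s t
  exact key _ _ _

/-- **`𝟙 ≠ 0` in `End(𝒪)`** on the site of opens over a non-empty open `W` of a scheme. [folklore] -/
theorem end_unit_id_ne_zero [Nonempty W] :
    (𝟙 (SheafOfModules.unit (X.ringCatSheaf.over W)) :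
      End (SheafOfModules.unit (X.ringCatSheaf.over W))) ≠ 0 := by
  intro h0
  have key := congrArg (fun u : SheafOfModules.unit (X.ringCatSheaf.over W) ⟶
      SheafOfModules.unit (X.ringCatSheaf.over W) =>
        ((u.val.app (op (Over.mk (𝟙 W)))).hom
          (1 : (X.ringCatSheaf.over W).obj.obj (op (Over.mk (𝟙 W)))) :
          (X.ringCatSheaf.over W).obj.obj (op (Over.mk (𝟙 W))))) h0
  change (1 : Γ(X, W)) = 0 at key
  exact one_ne_zero key

end EndUnit

/-! ## The converse: vector bundles are finite locally free -/

section Converse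

variable {X : Scheme.{u}}

/-- **A vector bundle (Mathlib: locally free and of finite type) on a scheme is finite locally free**
(The Stacks project, Tag 01C6: Def. 17.14.1 (1) + finite type ⇒ Def. 17.14.1 (2) on a locally ringed
space). Proof: at `x`, let `E|_U ≅ 𝒪^I` be a trivialisation and `E|_V` be generated by finitely many
sections (`K` of them); over `W = U ∩ V ∋ x` both restrict (restriction to the opens over `W` is a left
adjoint, so it preserves epimorphisms), giving an epimorphism `𝒪^K ↠ 𝒪^I` over `W ≠ ∅`, whence `I` is
finite (`finite_of_epi_free`). This is the converse of the tree's `IsFiniteLocallyFree.isVectorBundle`.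
[cite: StacksProject, Tag 01C6] -/
theorem isFiniteLocallyFree_of_isVectorBundle {E : X.Modules} (h : IsVectorBundle E) :
    IsFiniteLocallyFree E := by
  classical
  obtain ⟨q, hq⟩ := h.1.exists_isLocallyFreeData
  haveI := h.2
  obtain ⟨q', hq'⟩ := SheafOfModules.IsFiniteType.exists_localGeneratorsData E
  intro x
  obtain ⟨a, ha⟩ := ((Opens.coversTop_iff _ q.X).mp q.coversTop).exists_mem x
  obtain ⟨b, hb⟩ := ((Opens.coversTop_iff _ q'.X).mp q'.coversTop).exists_mem x
  refine ⟨q.X a, ha, (q.generators a).I, ?_, ⟨asIso (q.generators a).π⟩⟩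
  -- it remains to see that the index set `I` of the trivialisation at `x` is finite
  let W : X.Opens := q.X a ⊓ q'.X b
  haveI : Nonempty W := ⟨⟨x, ⟨ha, hb⟩⟩⟩
  haveI : (q'.generators b).IsFiniteType := hq'.isFiniteType b
  -- the trivialisation restricted to `W`
  let eW : SheafOfModules.free (q.generators a).I ≅ E.over W :=
    SheafOfModules.restrictTrivialisation (R := X.ringCatSheaf) (homOfLE inf_le_left)
      (asIso (q.generators a).π)
  -- the finitely many generators restricted to `W`
  let g : W ⟶ q'.X b := homOfLE inf_le_right
  let πW : SheafOfModules.free (q'.generators b).I ⟶ E.over W :=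
    (SheafOfModules.mapFreeIso (SheafOfModules.overMap X.ringCatSheaf g) _
        (SheafOfModules.overMapUnitIso g).symm).hom ≫
      (SheafOfModules.overMap X.ringCatSheaf g).map (q'.generators b).π ≫
        ((SheafOfModules.overFunctorMap X.ringCatSheaf g).app E).hom
  haveI : Epi πW := by
    dsimp only [πW]
    infer_instance
  exact finite_of_epi_free (end_unit_mul_comm W) (end_unit_id_ne_zero W) (πW ≫ eW.inv)

/-- The converse in the shape of the hypothesis `hconv` of `Negative/OneStepClassLift.lean`.
[folklore] -/
theorem vectorBundleConverse (Y : Scheme.{0}) (E : Y.Modules) (hE : IsVectorBundle E) :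
    IsFiniteLocallyFree E :=
  isFiniteLocallyFree_of_isVectorBundle hE

end Converse

/-! ## The kill criterion, unconditionally -/

section Unconditional

variable {p : ℕ} [Fact p.Prime] {k : Type} [Field k] [CharP k p] {𝒳 : SchemeOver (WittVector p k)}

/-- **A formal lift gives a one-step class lift**: if `E₁` lifts formally then
`[E₁] ∈ im(K₀(𝒳 ⊗ W/p²) → K₀(X_k))` (no hypothesis on `𝒳`). [folklore] -/
theorem exists_oneStepClassLift_of_liftsFormally {E₁ : (specialFibre 𝒳).left.Modules}
    (hE₁ : IsFiniteLocallyFree E₁) (hL : LiftsFormally 𝒳 E₁) :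
    ∃ y : KTheory.KZero (thickening 𝒳 2).left,
      KTheory.KZero.map (specialFibreToThickening 𝒳 1) y = KTheory.KZero.of E₁ hE₁ :=
  oneStepClassLift_of_liftsFormally vectorBundleConverse hE₁ hL

variable [PerfectRing k p]

/-- **ONE-STEP CLASS LIFTING IS NECESSARY FOR THE CRUX** (unconditional): under the hypotheses of
`FormalLiftingFromClassLifting`, every finite locally free `E₁` with a rational pro-lift of its class has
`[E₁] ∈ im(K₀(𝒳 ⊗ W/p²) → K₀(X_k))`. [folklore] -/
theorem exists_oneStepClassLift_of_formalLiftingFromClassLifting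
    (hcrux : FormalLiftingFromClassLifting) {d : ℕ}
    (h₁ : IsSmoothProperModel d 𝒳) (h₂ : Crystalline.IsProjectiveOverRing 𝒳) (h₃ : d + 6 < p)
    (h₄ : ∀ (b : ℕ) (x : structureSheafCohomology 𝒳.left b), (p : ℤ) • x = 0 → x = 0)
    (h₅ : ∀ (b : ℕ) (x : hodgeCohomologyOne 𝒳 b), (p : ℤ) • x = 0 → x = 0)
    (h₆ : d ≤ 3 ∨ Nonempty (cotangentSheaf 𝒳 ≅ SheafOfModules.free (R := 𝒳.left.ringCatSheaf) (Fin d)))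
    {E₁ : (specialFibre 𝒳).left.Modules} (hE₁ : IsFiniteLocallyFree E₁)
    (hr : ∃ ξ : KTheory.ContinuousKZeroRat (Ideal.span {(p : WittVector p k)}) 𝒳,
      KTheory.KZeroRat.map (Crystalline.specialFibreToTower 𝒳)
        (KTheory.ContinuousKZeroRat.specialFibre (Ideal.span {(p : WittVector p k)}) 𝒳 ξ) =
        KTheory.KZeroRat.of E₁ hE₁) :
    ∃ y : KTheory.KZero (thickening 𝒳 2).left,
      KTheory.KZero.map (specialFibreToThickening 𝒳 1) y = KTheory.KZero.of E₁ hE₁ :=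
  oneStepClassLift_of_formalLiftingFromClassLifting vectorBundleConverse hcrux h₁ h₂ h₃ h₄ h₅ h₆ hE₁ hr

omit [PerfectRing k p]

/-- **KILL CRITERION (unconditional).** A single one-step witness — `(p, k, d, 𝒳)` under the hypotheses
of the crux and a finite locally free `E₁` on `X_k` with a rational pro-lift of `[E₁] ⊗ 1` whose
integral class does not lift to `K₀(𝒳 ⊗ W/p²)` — refutes `FormalLiftingFromClassLifting`. [folklore] -/
theorem not_formalLiftingFromClassLifting_of_oneStepWitness'
    (w : ∃ (p : ℕ) (_ : Fact p.Prime) (k : Type) (_ : Field k) (_ : CharP k p) (_ : PerfectRing k p)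
      (d : ℕ) (𝒳 : SchemeOver (WittVector p k)),
      IsSmoothProperModel d 𝒳 ∧ Crystalline.IsProjectiveOverRing 𝒳 ∧ d + 6 < p ∧
      (∀ (b : ℕ) (x : structureSheafCohomology 𝒳.left b), (p : ℤ) • x = 0 → x = 0) ∧
      (∀ (b : ℕ) (x : hodgeCohomologyOne 𝒳 b), (p : ℤ) • x = 0 → x = 0) ∧
      (d ≤ 3 ∨ Nonempty (cotangentSheaf 𝒳 ≅ SheafOfModules.free (R := 𝒳.left.ringCatSheaf) (Fin d))) ∧
      ∃ (E₁ : (specialFibre 𝒳).left.Modules) (hE₁ : IsFiniteLocallyFree E₁),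
        (∃ ξ : KTheory.ContinuousKZeroRat (Ideal.span {(p : WittVector p k)}) 𝒳,
          KTheory.KZeroRat.map (Crystalline.specialFibreToTower 𝒳)
            (KTheory.ContinuousKZeroRat.specialFibre (Ideal.span {(p : WittVector p k)}) 𝒳 ξ) =
            KTheory.KZeroRat.of E₁ hE₁) ∧
        ¬ ∃ y : KTheory.KZero (thickening 𝒳 2).left,
          KTheory.KZero.map (specialFibreToThickening 𝒳 1) y = KTheory.KZero.of E₁ hE₁) :
    ¬ FormalLiftingFromClassLifting :=
  not_formalLiftingFromClassLifting_of_oneStepWitness vectorBundleConverse w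

end Unconditional

end

end Summit.HodgeConjecture.HodgeConjecture.Theorems.FormalLiftingFromClassLifting.Negative
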